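import Summits.QuantumFields.YangMills.Theorems.BalabanUVNodesN22W1RelCentredSliceInputsLGU
import Literature.MathematicalPhysics.QuantumFieldTheory.Balaban1983to89.B13TermWalkDataOneTorus
import Summits.QuantumFields.YangMills.Theorems.BalabanUVNodesN22W1RelCentredSliceInputsLGWitness

/-!
# BalabanUVNodes ∕ node N22 = NE9 — THE RELATIVE-DISC CENTRED ROAD OVER THE ADMISSIBLE CLASS, MODULE J12-W: THE UNIFORM ∕ PRIMITIVE LOCATED-INPUT RECORD `SliceInputsLGU` IS
# INHABITED ON THE WHOLE CONFIGURATION SPACE (`W := univ`) AT EVERY LABEL WITH LARGE-FIELD BOXES (`1 ≤ |P(t)|`) — first half of the A6 witness for the knit J12-K (second half,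
# `P(t) = ∅`: the sibling J12-Wb)

Cell `pub-ymgap`, HUMAN RULING D-0062 (Track A), R134 ACCELERATION re-seat `pub-ymgap-dag-n22-c` (strategy s1), generation 9, file J12-W.  THEOREMS ONLY; imports J12-D
`…N22W1RelCentredSliceInputsLGU` (the uniform ∕ primitive record) and `B13TermWalkDataOneTorus` (NODE A's FREE kernels `freeKernels`, node00-def-W1 W1-7∕W1-15's honesty datum) and the sibling J10-W `…SliceInputsLGWitness` for its elementary rate fact `exp_neg_posLog_le` BY NAME (not re-declared).
`--supports` K3⁷ `SpineGivenEndpointR13SepCoPH` (stmt-QuantumFields-20544) as a helper.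

WHY.  Standing rule №189 ∕ director-ym №193 (A6): a knit whose located-input binder is a RECORD TYPE must come with an in-tree inhabitant of that type, in both regimes of the
large-field set.  Module J12-K re-knits J10c over the NEW record type `SliceInputsLGU 𝔇 χᵘ χᶜᵘ 𝒲 𝒪 c Sg Rz cs E₀ κ_E Z t W s₀ a a₅ ρb Mv` (J12-D: J10-D's letters asked UNIFORMLY on an
open thickening `W`, the two integral-level φ-analyticity fields replaced by four primitive φ-laws).  THIS FILE is the FIRST HALF of its A6 witness: the type is INHABITED with `W := univ`
(the whole configuration space, trivially open) — at every label `t` with `1 ≤ |P(t)|` — for EVERY nonempty domain `Z`, tables `(Sg, Rz, cs)`, size letters `(E₀, κ_E)`, weight letter `a`, base point `s₀ > 0` and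
vertex constant `Mv > 1`, at `ρb = 1∕12`, `a₅ = 2`, for every constants record `c` with the elementary sign ∕ size conditions behind W1-8's `0 < invTau c d ≤ ½`.  The inhabitant is
module J10-W's VERBATIM (GENERATED from the tree's J10-W by `gen/build_j12w.py`): W1-7's DEGENERATE datum — free kernels on ONE row bond (`A ≡ 1`, `G ≡ 0`, `Γ₀ = 0`, `C = 1`,
zero-dimensional site torus), Cauchy radius `1`, zero potentials `𝒲 = 𝒪 = 0`, boxes `χᵘ = χᶜᵘ ≡ 0` (print: a large-field term's characteristic functions vanish near `B′ = 0`) with the (2.22) radius `r_P² = r₁² + 40·log⁺(1∕(Mv s₀²))`; since the datum's kernels are CONFIGURATION-FREE (`uOf ≡ 0`, `A(ψ,σ) = 1`,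
`G(σ, uOf ψ) = 0` for every `ψ`) and its potentials vanish, each of the twenty configuration-dependent fields holds at EVERY `ξ ∈ univ` by the old proof, and the four primitive
φ-laws `hAd`, `hGd`, `h𝒲d`, `h𝒪d` are `differentiableOn_const`.  Nothing of print's.

HONEST FRAMING.  An INHABITATION witness of a HYPOTHESIS RECORD at degenerate data (A6: «the binder is not contradictory, in both regimes, at the knit's side of `Mv`»); it asserts
NOTHING of Bałaban's and does NOT inhabit the record at the datum OF RECORD on a thickening of the table of record (NODE A's ∕ N09's ∕ N10's ∕ def-W1's business); a JOINT witness with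
the knit's numerals ∕ `hlaw` ∕ N18-below is NOT claimed; count-neutral; N22 NOT discharged; one finite four-torus programme at fixed ε — NOT infinite volume, NOT OS on ℝ⁴, NOT a mass gap,
NOT Clay.  0 `sorry`, 0 `def`, standard axioms.

References (TYPES only): [II] = [Balaban1988RG2Cluster] (1.5) p. 3, (2.3) p. 12, (2.14) p. 15, (2.22) p. 16; [I] = [Balaban1987RG1] (2.9)–(2.13) pp. 266–268.
-/

noncomputable section

namespace YMDAG.N22.W1

open Set Metric Matrix
open scoped BigOperators
open Literature.MathematicalPhysics.QuantumFieldTheory.Balaban1983to89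
open Literature.MathematicalPhysics.QuantumFieldTheory.Balaban1983to89.TreeLengthTorus (TPt TDom tsys torusTreeLen torusTreeLen_nonneg)
open Literature.MathematicalPhysics.QuantumFieldTheory.Balaban1983to89.B13Bound143 (invTau invTau_pos)
open Literature.MathematicalPhysics.QuantumFieldTheory.Balaban1983to89.B9Thm37GlueTorus (tdist1 tdist1_self)
open Literature.MathematicalPhysics.QuantumFieldTheory.Balaban1983to89.B5TorusCover (UT)
open Literature.MathematicalPhysics.QuantumFieldTheory.Balaban1983to89.B13TermWalkDataOneTorus (freeKernels)
open Literature.MathematicalPhysics.QuantumFieldTheory.Balaban1983to89.B13Term214 (term214 core214 F214)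
open Literature.MathematicalPhysics.QuantumFieldTheory.Balaban1983to89.Step (SFConsts)
open Literature.MathematicalPhysics.QuantumFieldTheory.Balaban1983to89.Node00.Sect2 (domSys domCount CPair spaceI domSites Setting Residual)
open Literature.MathematicalPhysics.QuantumFieldTheory.Balaban1983to89.Node00.W1

variable (c : B13.Consts) (P : Params) (𝔸 : Type*) [NormedRing 𝔸] [NormedAlgebra ℂ 𝔸] [CompleteSpace 𝔸] (M k L : ℕ) [NeZero L]

/-! ## §1 The record is inhabited at a label WITH large-field boxes (`1 ≤ |P(t)|`) -/

open Classical in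
/-- **★ `SliceInputsLGU` IS INHABITED ON THE WHOLE CONFIGURATION SPACE (`W := univ`) AT EVERY LABEL WITH `1 ≤ |P(t)|`** (the regime ref-G's probe found contradictory in J9-D) — for every nonempty domain `Z`,
tables, size letters, weight letter `a`, base point `s₀ > 0` and vertex constant `Mv > 1`, at `ρb = 1∕12`, `a₅ = 2`, for every constants record `c` with `κ₁ ≥ 1`, positive
`E₀, ε₁, C₁, α₄, M`, `(1 − 3δ)κ ≥ 0` and `E₀ε₁C₁α₄⁻¹M^q e^{C₂κ₁} ≤ ½` (W1-8's `0 < invTau ≤ ½`): witnessed by W1-7's degenerate datum (free kernels on one row bond, CONFIGURATION-FREE — so every configuration-dependent field holds at every `ξ`, and the four primitive φ-laws are `differentiableOn_const`), zero potentials,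
VANISHING boxes `χᵘ = χᶜᵘ ≡ 0`, and the (2.22) radius `r_P² = r₁² + 40·log⁺(1∕(Mv s₀²))`.  A6 witness; nothing of print's. [cite: Balaban1988RG2Cluster, (2.3) p.12 and (2.22) p.16 (degenerate data; bookkeeping)] -/
theorem sliceInputsLGU_inhabited_largeField (hκ₁ : 1 ≤ c.κ₁) (hE : 0 < c.E₀) (hε : 0 < c.ε₁) (hC₁ : 0 < c.C₁) (hα : 0 < c.α₄) (hMc : 0 < c.M)
    (hδκ : 0 ≤ (1 - 3 * c.δ) * c.κ) (hpref : c.E₀ * c.ε₁ * c.C₁ * c.α₄⁻¹ * c.M ^ c.q * Real.exp (c.C₂ * c.κ₁) ≤ 1 / 2)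
    {G : Type*} [GaugeGroup G] (Sg : Setting 𝔸 G) (Rz : Residual P 𝔸) (cs : SFConsts) (E₀ κE : ℝ)
    (Z : (domSys P M (k + 1)).Dom) (hZ : 1 ≤ (Z.1).card) (t : TermLabel P M k L) (hP : 1 ≤ t.2.card)
    {s₀ Mv : ℝ} (hs₀ : 0 < s₀) (hMv : 1 < Mv) (a : ℝ) :
    ∃ (𝔇 : TermDatum214 c P 𝔸 M k L)
      (χu χcu : (Z : (domSys P M (k + 1)).Dom) → (t : TermLabel P M k L) → ((𝔇.𝒦 Z t).Λ → ℝ) → ℝ)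
      (𝒲 : (Z : (domSys P M (k + 1)).Dom) → (t : TermLabel P M k L) → CPair P 𝔸 → TDom P.d (L * domCount P M (k + 1)) → ((𝔇.𝒦 Z t).Λ → ℝ) → ℂ)
      (𝒪 : (Z : (domSys P M (k + 1)).Dom) → (t : TermLabel P M k L) → OlderTerms P 𝔸 M k → CPair P 𝔸 → TDom P.d (L * domCount P M (k + 1)) →
        ((𝔇.𝒦 Z t).Λ → ℝ) → ℂ),
      Nonempty (SliceInputsLGU 𝔇 χu χcu 𝒲 𝒪 c Sg Rz cs E₀ κE Z t Set.univ s₀ a 2 (1 / 12) Mv) := by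
  haveI hNe : ∀ i : Fin 0, NeZero ((![] : Fin 0 → ℕ) i) := fun i => i.elim0
  let z : UT (![] : Fin 0 → ℕ) := UT.ofSite (N := (![] : Fin 0 → ℕ)) fun i => i.elim0
  -- W1-7's degenerate datum, kept OPAQUE (an equation `h𝔇`) so that the record's baked instances are found syntactically
  obtain ⟨𝔇, h𝔇⟩ : ∃ 𝔇 : TermDatum214 c P 𝔸 M k L, 𝔇 =
      { ν := 0, Nf := ![], E₃ := ℂ,
        𝒦 := fun _ _ => freeKernels c ℂ Unit Empty (fun _ => z) (fun _ => z),
        finC₀ := fun _ _ => inferInstanceAs (Fintype Empty),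
        decC₀ := fun _ _ => inferInstanceAs (DecidableEq Empty),
        uOf := fun _ _ _ => 0, r := 1,
        chiY₀ := fun _ _ _ _ => 0, chicP := fun _ _ _ _ => 0,
        𝒱 := fun _ _ _ _ _ _ _ => 0 } := ⟨_, rfl⟩
  have hPne : t.2 ≠ ∅ := fun h => by rw [h, Finset.card_empty] at hP; exact Nat.not_succ_le_zero 0 hP
  -- the datum's reductions (by `subst`, each in its own `have`)
  have hA1 : ∀ (ψ : CPair P 𝔸) (σ : TPt P.d (domCount P M (k + 1)) → ℂ), 𝔇.A Z t ψ σ = 1 := by intro ψ σ; subst h𝔇; rfl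
  have hG0 : ∀ (σ : TPt P.d (domCount P M (k + 1)) → ℂ) (ψ : CPair P 𝔸), (𝔇.𝒦 Z t).G2 σ (𝔇.uOf Z t ψ) = 0 := by intro σ ψ; subst h𝔇; rfl
  have hΓ0 : (𝔇.𝒦 Z t).Γ₀ = 0 := by subst h𝔇; rfl
  have hC1 : (𝔇.𝒦 Z t).C = 1 := by subst h𝔇; rfl
  have hm : (𝔇.𝒦 Z t).m = 1 := by subst h𝔇; rfl
  have hpow : ∀ x : ℝ, x ^ 𝔇.ν = 1 := fun x => by subst h𝔇; exact pow_zero x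
  have hr1 : 𝔇.r = 1 := by subst h𝔇; rfl
  have hGam : ∀ (ψ : CPair P 𝔸) (σ : TPt P.d (domCount P M (k + 1)) → ℂ) (X : (𝔇.𝒦 Z t).Λ ⊕ (𝔇.𝒦 Z t).C₀ → ℝ), 𝔇.Gam Z t ψ σ X = 0 := by
    intro ψ σ X; rw [TermDatum214.Gam, hG0, Matrix.zero_mulVec]
  have hcardΛ : Fintype.card (𝔇.𝒦 Z t).Λ = 1 := by subst h𝔇; exact Fintype.card_unit
  have hcardΛC : Fintype.card ((𝔇.𝒦 Z t).Λ ⊕ (𝔇.𝒦 Z t).C₀) = 1 := by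
    have h0 : Fintype.card (𝔇.𝒦 Z t).C₀ = 0 := Fintype.card_eq_zero_iff.2 ⟨fun x => by subst h𝔇; exact Empty.elim x⟩
    rw [Fintype.card_sum, hcardΛ, h0]
  -- W1-8's located τ-letters from the elementary conditions on `c`
  have hposY : ∀ Y : TDom P.d (L * domCount P M (k + 1)), 0 < invTau c ((tsys P.d (L * domCount P M (k + 1))).dj Y) := fun Y =>
    invTau_pos c hE hε hC₁ hα hMc _
  have hhalfY : ∀ Y : TDom P.d (L * domCount P M (k + 1)), invTau c ((tsys P.d (L * domCount P M (k + 1))).dj Y) ≤ 1 / 2 := by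
    intro Y
    have hd : 0 ≤ (tsys P.d (L * domCount P M (k + 1))).dj Y := torusTreeLen_nonneg Y.1
    have hpref0 : 0 ≤ c.E₀ * c.ε₁ * c.C₁ * c.α₄⁻¹ * c.M ^ c.q * Real.exp (c.C₂ * c.κ₁) := by positivity
    unfold invTau
    calc c.E₀ * c.ε₁ * c.C₁ * c.α₄⁻¹ * c.M ^ c.q * Real.exp (c.C₂ * c.κ₁) * Real.exp (-(1 - 3 * c.δ) * c.κ * (tsys P.d (L * domCount P M (k + 1))).dj Y)
        ≤ c.E₀ * c.ε₁ * c.C₁ * c.α₄⁻¹ * c.M ^ c.q * Real.exp (c.C₂ * c.κ₁) * 1 := by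
          refine mul_le_mul_of_nonneg_left (Real.exp_le_one_iff.2 ?_) hpref0
          have : 0 ≤ (1 - 3 * c.δ) * c.κ * (tsys P.d (L * domCount P M (k + 1))).dj Y := mul_nonneg hδκ hd
          linarith
      _ ≤ 1 / 2 := by rw [mul_one]; exact hpref
  -- the (2.22) radius from the large-field rate
  set y : ℝ := max 0 (-Real.log (Mv * s₀ ^ 2)) with hy
  have hy0 : 0 ≤ y := le_max_left _ _
  have hMv0 : 0 < Mv := zero_lt_one.trans hMv
  have hrate : Real.exp (-y) ≤ Mv * s₀ ^ 2 := exp_neg_posLog_le (by positivity)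
  set r₁ : ℝ := Real.sqrt (20 * max a 0) with hr₁def
  set rP : ℝ := Real.sqrt (20 * max a 0 + 40 * y) with hrPdef
  have hr₁sq : r₁ ^ 2 = 20 * max a 0 := Real.sq_sqrt (by positivity)
  have hrPsq : rP ^ 2 = 20 * max a 0 + 40 * y := Real.sq_sqrt (by positivity)
  refine ⟨𝔇, fun _ _ _ => 0, fun _ _ _ => 0, fun _ _ _ _ _ => 0, fun _ _ _ _ _ _ => 0, ⟨?_⟩⟩
  exact
    { Uσ := univ,
      Uτ := fun Y => ball 0 ((invTau c ((tsys P.d (L * domCount P M (k + 1))).dj Y))⁻¹ + 3),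
      γ₂ := 1 / 20,
      rP := rP,
      qP := fun B => B ⬝ᵥ B,
      kap := 3,
      kap' := 2,
      kap'' := 1,
      θ := 1 / 5,
      θE := 0,
      θΓ := 0,
      θC := 0,
      KG := 0,
      KΓ := 0,
      KCs := 1,
      K₀ := 1,
      KE := 1,
      KG' := 0,
      KCs' := ((1 - 1 / 12) ^ 2)⁻¹,
      θΓ' := 0,
      θC' := 1 / 12 * (2 + 1 / 12) * ((1 - 1 / 12) ^ 2)⁻¹ * 1,
      θE' := 1 / 12 * (2 + 1 / 12),
      a' := 0,
      w' := 0,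
      cE := 1,
      g := 0,
      Rb := 0,
      κ := 1 / 20,
      a₀ := 0,
      w₀ := 0,
      T := Mv - 1,
      α₀ := 0,
      r₁ := r₁,
      TP := Mv,
      ac := 1 / 20,
      wc := 0,
      hpos := hposY,
      hhalf := hhalfY,
      hW := isOpen_univ,
      hUσ := isOpen_univ,
      hUτ := fun _ => isOpen_ball,
      hUexp := subset_univ _,
      hUtau := fun Y => closedBall_subset_ball (by linarith),
      hr := by rw [hr1]; exact zero_lt_one,
      hr' := by rw [hr1]; linarith [Real.add_one_le_exp c.κ₁],
      hsubτ := by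
        intro Y x hx w hw
        rw [Set.uIcc_of_le zero_le_one] at hx
        rw [mem_closedBall, hr1] at hw
        rw [mem_ball, dist_zero_right]
        have hx1 : ‖(x : ℂ)‖ ≤ 1 := by rw [Complex.norm_real, Real.norm_eq_abs]; exact abs_le.2 ⟨by linarith [hx.1], hx.2⟩
        have hinv : 0 < (invTau c ((tsys P.d (L * domCount P M (k + 1))).dj Y))⁻¹ := inv_pos.2 (hposY Y)
        calc ‖w‖ = ‖(w - (x : ℂ)) + (x : ℂ)‖ := by rw [sub_add_cancel]
          _ ≤ ‖w - (x : ℂ)‖ + ‖(x : ℂ)‖ := norm_add_le _ _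
          _ ≤ 1 + 1 := add_le_add (by rw [← dist_eq_norm]; exact hw) hx1
          _ < (invTau c ((tsys P.d (L * domCount P M (k + 1))).dj Y))⁻¹ + 3 := by linarith,
      hχ0 := fun _ => le_rfl,
      hχc0 := fun _ => le_rfl,
      hχm := measurable_const,
      hχcm := measurable_const,
      h222 := fun B => by rw [zero_mul]; exact (Real.exp_pos _).le,
      hγ₂ := by norm_num,
      hqP := fun _ => le_rfl,
      hAhol := fun _ _ i j => by simp only [hA1]; exact differentiableOn_const _,
      hGhol := fun _ _ i j => by simp only [hG0]; exact differentiableOn_const _,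
      hAd := fun σ _ i j => by simp only [hA1]; exact differentiableOn_const _,
      hGd := fun σ _ i j => by simp only [hG0]; exact differentiableOn_const _,
      hAs := fun _ _ σ _ => by rw [hA1]; exact Matrix.isSymm_one,
      hfibN := fun x => (Finset.card_filter_le _ _).trans (by rw [Finset.card_univ, hcardΛC, hm]),
      hkap'' := by norm_num,
      hk1 := by norm_num,
      hk2 := by norm_num,
      hθE := le_rfl,
      hθΓ := le_rfl,
      hθC := le_rfl,
      hKG := le_rfl,
      hKΓ := le_rfl,
      hKCs := zero_le_one,
      hK₀ := zero_le_one,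
      hKE := zero_le_one,
      hG := fun _ _ σ _ b j => by rw [hG0, Matrix.zero_apply, norm_zero, zero_mul],
      hΓ₀ := fun b j => by rw [hΓ0, Matrix.zero_apply, norm_zero, zero_mul],
      hCs := fun _ _ σ _ b b' => by
        rw [hA1, inv_one]
        by_cases hb : b = b'
        · subst hb; rw [Matrix.one_apply_eq, norm_one, tdist1_self, mul_zero, neg_zero, Real.exp_zero, mul_one]
        · rw [Matrix.one_apply_ne hb, norm_zero]; positivity,
      hC216 := fun b b' => by
        rw [hC1]
        by_cases hb : b = b'
        · subst hb; rw [Matrix.one_apply_eq, norm_one, tdist1_self, mul_zero, neg_zero, Real.exp_zero, mul_one]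
        · rw [Matrix.one_apply_ne hb, norm_zero]; positivity,
      hCE := fun b b' => by
        rw [hC1, inv_one, Matrix.map_one _ (map_zero _) (map_one _)]
        by_cases hb : b = b'
        · subst hb; rw [Matrix.one_apply_eq, norm_one, tdist1_self, mul_zero, neg_zero, Real.exp_zero, mul_one]
        · rw [Matrix.one_apply_ne hb, norm_zero]; positivity,
      hdΓ := fun _ _ σ _ b j => by rw [hG0, hΓ0, Matrix.map_zero _ (map_zero _), sub_zero, Matrix.zero_apply, norm_zero, zero_mul],
      hdC := fun _ _ σ _ b b' => by rw [hA1, hC1, inv_one, Matrix.map_one _ (map_zero _) (map_one _), sub_self, Matrix.zero_apply, norm_zero, zero_mul],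
      hdE := fun _ _ σ _ b b' => by rw [hA1, hC1, inv_one, Matrix.map_one _ (map_zero _) (map_one _), sub_self, Matrix.zero_apply, norm_zero, zero_mul],
      hKG' := by norm_num,
      hKCs' := by norm_num,
      hθΓ' := by norm_num,
      hθC' := by norm_num,
      hθE' := by norm_num,
      hθEle := by norm_num,
      hθΓle := by norm_num,
      hθR1le := by simp only [hpow, hm, Nat.cast_one, mul_one]; norm_num,
      hsmallKθ := by simp only [hpow, hm, Nat.cast_one, mul_one]; norm_num,
      hc0 := zero_le_one,
      hc := fun i => by
        haveI : Nonempty (𝔇.𝒦 Z t).Λ := ⟨i⟩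
        have h : (𝔇.𝒦 Z t).hC.1.eigenvalues i ∈ spectrum ℝ (1 : Matrix (𝔇.𝒦 Z t).Λ (𝔇.𝒦 Z t).Λ ℝ) := by
          have h0 := (𝔇.𝒦 Z t).hC.1.eigenvalues_mem_spectrum_real i
          rwa [show spectrum ℝ (𝔇.𝒦 Z t).C = spectrum ℝ (1 : Matrix (𝔇.𝒦 Z t).Λ (𝔇.𝒦 Z t).Λ ℝ) by rw [hC1]] at h0
        rw [spectrum.one_eq, Set.mem_singleton_iff] at h
        exact h.le,
      hαc := by simp only [hpow, hm, Nat.cast_one, mul_one]; norm_num,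
      hg := le_rfl,
      hΓq := fun X => by rw [hΓ0, Matrix.zero_mulVec, zero_dotProduct, zero_mul],
      hsmall := by simp only [hpow, hm, Nat.cast_one, mul_one]; norm_num,
      hPa := by rw [hrPsq]; nlinarith [le_max_left a 0, le_max_right a 0, hy0],
      hvol := by
        have h1 : (1 : ℝ) ≤ ((Z.1).card : ℝ) := Nat.one_le_cast.mpr hZ
        simp only [hpow, hm, hcardΛ, hcardΛC, Nat.cast_one, mul_one, one_mul]
        nlinarith [h1],
      hχe := fun _ => rfl,
      hχce := fun _ => rfl,
      hαc_c := by simp only [hpow, hm, Nat.cast_one, mul_one]; norm_num,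
      hsmall_c := by simp only [hpow, hm, Nat.cast_one, mul_one]; norm_num,
      hvol_c := by
        have h1 : (1 : ℝ) ≤ ((Z.1).card : ℝ) := Nat.one_le_cast.mpr hZ
        simp only [hpow, hm, hcardΛ, hcardΛC, Nat.cast_one, mul_one, one_mul]
        nlinarith [h1],
      hχ1 := fun h => absurd h hPne,
      hκ := by norm_num,
      hboxR := fun h => absurd h hPne,
      ha₀ := le_rfl,
      hαc_b := by simp only [hpow, hm, Nat.cast_one, mul_one]; norm_num,
      hsmall_b := by simp only [hpow, hm, Nat.cast_one, mul_one]; norm_num,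
      hvol_b := by
        have h1 : (1 : ℝ) ≤ ((Z.1).card : ℝ) := Nat.one_le_cast.mpr hZ
        simp only [hpow, hm, hcardΛ, hcardΛC, Nat.cast_one, mul_one, one_mul]
        nlinarith [h1],
      hα₀ := le_rfl,
      hαc_f := by simp only [hpow, hm, Nat.cast_one, mul_one]; norm_num,
      hsmall_f := by simp only [hpow, hm, Nat.cast_one, mul_one]; norm_num,
      hr₁ := fun _ => by rw [hr₁sq, hrPsq]; linarith,
      hPa1 := fun _ => by rw [hr₁sq]; nlinarith [le_max_left a 0, le_max_right a 0],
      hA := fun _ _ σ _ => by rw [hA1, Matrix.map_one _ Complex.zero_re Complex.one_re]; exact Matrix.PosDef.one,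
      hθEle0 := by norm_num,
      hθΓle0 := by norm_num,
      hθR1le0 := by simp only [hpow, hm, Nat.cast_one, mul_one]; norm_num,
      hαc_0 := by simp only [hpow, hm, Nat.cast_one, mul_one]; norm_num,
      hsmall_0 := by simp only [hpow, hm, Nat.cast_one, mul_one]; norm_num,
      hvol_0 := by
        have h1 : (1 : ℝ) ≤ ((Z.1).card : ℝ) := Nat.one_le_cast.mpr hZ
        simp only [hpow, hm, hcardΛ, hcardΛC, Nat.cast_one, mul_one, one_mul]
        nlinarith [h1],
      hRb := fun h => absurd h hPne,
      hTP := fun _ => by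
        rw [hrPsq, hr₁sq]
        have : -(1 / 20 / 2 * (20 * max a 0 + 40 * y - 20 * max a 0)) = -y := by ring
        rw [this]
        exact hrate,
      hMvT := fun h => absurd h hPne,
      hMvP := fun _ => le_rfl,
      𝒲₃ := fun _ _ => 0,
      D𝒪 := fun _ _ _ => 0,
      ρ := 1,
      hρ := zero_lt_one,
      h𝒲m := fun _ _ _ => measurable_const,
      h𝒲d := fun _ _ => differentiableOn_const _,
      h𝒲₃m := fun _ => measurable_const,
      h𝒲₃ := fun _ _ _ => by rw [mul_zero],
      R := fun Y => (invTau c ((tsys P.d (L * domCount P M (k + 1))).dj Y))⁻¹ + 3,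
      c₀ := fun _ => 0,
      c₃ := fun _ => 0,
      c₃' := fun _ => 0,
      c₄ := fun _ => 0,
      c₁ := fun _ => 0,
      c₁' := fun _ => 0,
      c₂ := fun _ => 0,
      hR := fun Y _ => by have := inv_pos.2 (hposY Y); linarith,
      hc₃ := fun _ _ => le_rfl,
      hc₃' := fun _ _ => le_rfl,
      hc₄ := fun _ _ => le_rfl,
      hc₁ := fun _ _ => le_rfl,
      hc₁' := fun _ _ => le_rfl,
      hc₂ := fun _ _ => le_rfl,
      hUτR := fun Y _ w hw => by rw [mem_ball, dist_zero_right] at hw; exact hw.le,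
      h1 := fun _ _ _ _ _ _ => by rw [norm_zero, zero_mul],
      S := fun _ => ∅,
      h1loc := fun _ _ _ _ _ _ => by rw [norm_zero, zero_mul, zero_mul],
      cubeOf := fun _ _ => 0,
      hS := fun _ _ b hb => absurd hb (Finset.notMem_empty _),
      Cp := 0,
      κp := B12TreeDecay.kappa₀ (4 * 2 ^ P.d) (2 * P.d),
      hCp := le_rfl,
      hκp := le_rfl,
      hdecay := fun _ _ => by rw [mul_zero, zero_mul],
      h2 := fun _ _ _ _ _ _ => by rw [sub_zero, norm_zero, zero_mul],
      h3 := fun _ _ _ => by rw [norm_zero, zero_mul],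
      S₀ := ∅,
      hbox := fun _ h => absurd rfl h,
      hloc𝒲 := fun _ _ _ _ _ _ _ => rfl,
      δ := 1 / 40,
      hδ := by norm_num,
      h𝒪m := fun _ _ _ _ _ => measurable_const,
      h𝒪d := fun _ _ _ _ => differentiableOn_const _,
      hD𝒪m := fun _ _ _ => measurable_const,
      hD𝒪 := fun _ _ _ _ _ => by rw [mul_zero],
      h0 := fun _ _ _ _ _ _ => by rw [norm_zero],
      h4 := fun _ _ _ _ _ _ _ _ => by rw [sub_zero, norm_zero, zero_mul],
      h5 := fun _ _ _ _ _ _ _ _ => by rw [sub_zero, sub_zero, norm_zero, zero_mul],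
      h6 := fun _ _ _ _ _ => by rw [norm_zero, zero_mul],
      hloc𝒪 := fun _ _ _ _ _ _ _ _ _ => rfl,
      hOhol := fun _ _ O _ cv _ _ Y A => differentiableOn_const _,
      ha' := by norm_num,
      hw' := by simp,
      hac := by norm_num,
      hwc := by simp,
      hw₀ := by simp }

end YMDAG.N22.W1

end
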